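import Summits.BirchSwinnertonDyer.BirchSwinnertonDyer.Theorems.KatoDescentPotSupersingularASideCountOfZetaLineIndex
import Mathlib.GroupTheory.Perm.Cycle.Type
import Mathlib.Data.Nat.Factors
import HarnessLib

/-!
# The level-0 count of crux M with the EXACT torsion slack: `… ≤ p^{v_p(c_p)} · #Sel_str^{ur}(W[p^∞]) · p^e · (p^{v_p #W(ℚ)_tors})²`
# (`#W(ℚ)[p^k]·#W(ℚ)[p^N]` divides the SQUARE OF THE `p`-PART of `#W(ℚ)_tors`, so the inequality reads in `ord_p` with `2·ord_p #W(ℚ)_tors` exactly)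
# (route `KatoDescentPotSupersingular` / `…Tame…`, crux M = stmt-BirchSwinnertonDyer-19196; route-free helper)

Seat `bsd-potss-rkm` g20 (prover; cell `bsd-potss`), item stmt-BirchSwinnertonDyer-19196 (`--supports … --as helper`; closes nothing).
HONEST FRAMING: BSD is not proved by any of this; nothing is booked; theorems only (no definition, no named fact).  CONDITIONAL on the named fact
`poitouTate_selmerStructure_duality ℚ` and on the displayed brick (b″), exactly as part 53.

## What

Part 53 (`tamagawa_mul_sha_mul_index_le_of_zetaLineIndex`) bounds by `(#W(ℚ)_tors)²`; since every other factor is a power of `p`, the faithful `ord_p`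
reading needs the `p`-part: `#G[p^k]` is a power of `p` (Cauchy) dividing `#G_tors`, hence divides `p^{v_p(#G_tors)}`.

* `natCard_torsionBy_pow_dvd_pow_padicValNat` — `#G[p^k] ∣ p^{v_p(#G_tors)}` for a finite abelian group `G`;
* **`tamagawa_mul_sha_mul_index_le_ppart_of_zetaLineIndex`** — part 53 with `(p^{v_p #W(ℚ)_tors})²` in place of `(#W(ℚ)_tors)²`:
  **`p^{v_p(Tam W)} · #Ш(W)[p^∞] · [A : ℤ_p y₀] ≤ p^{v_p(c_p)} · #Sel_str^{ur}(W[p^∞]) · p^e · p^{2·v_p(#W(ℚ)_tors)}`**.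

READING (all factors are powers of `p` once `#Sel_str^{ur}` and `[A : ℤ_p y₀]` are, as they are for these `p`-primary / `ℤ_p`-module quotients):
`v_p(Tam) + ord_p #Ш[p^∞] + ord_p [A : ℤ_p y₀] ≤ v_p(c_p) + ord_p #Sel_str^{ur} + e + 2·ord_p #W(ℚ)_tors`, and with `e = a + v_p(λ(0)) + t_p − v_p(c_p)` (Kato
14.18 + value) and (c2′) `ord_p #(𝐇²/X𝐇²) = ord_p #Sel_str^{ur} + t_p − t₀` this is the `count` clause of `Kato2004.MemberHullZetaInputs` with one `t₀` to spare.

References: K. Kato, Astérisque 295 (2004), Prop. 14.16 and its proof (pp. 244–245), Lemma 14.18 (pp. 247–248) [Kato2004Asterisque]; J. S. Milne, *ADT* I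
Thm. 4.10 (b) [MilneADT2006].
-/

-- the summit and its single problem are both named `BirchSwinnertonDyer` (registry layout D-0017)
set_option linter.dupNamespace false
set_option autoImplicit false

noncomputable section

open scoped Classical ContRepresentation NumberField AddSubgroup
open CategoryTheory Function Field NumberField IsDedekindDomain WeierstrassCurve
open Literature.NumberTheory.EllipticCurves Literature.NumberTheory.GaloisRepresentations
  Literature.NumberTheory.GaloisRepresentations.DiscreteGaloisModule Literature.NumberTheory.GaloisCohomology
open Literature.NumberTheory.EllipticCurves.Kato2004 Literature.NumberTheory.EllipticCurves.Kato2004.EulerSystemValues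
open Summit.BirchSwinnertonDyer.Rank1Residual.X11b.Levels Summit.BirchSwinnertonDyer.Rank1Residual.X11b.LocBridge
  Summit.BirchSwinnertonDyer.Rank1Residual.X11b.LevelKummer Summit.BirchSwinnertonDyer.Rank1Residual.X11b.FiniteDuality
  Summit.BirchSwinnertonDyer.Rank1Residual.X11b.AcSelmer
open Summit.BirchSwinnertonDyer.Rank1Residual.GaloisImage
open Summit.BirchSwinnertonDyer.BirchSwinnertonDyer.Theorems.KummerTowerOrthogonal
open Summit.BirchSwinnertonDyer.BirchSwinnertonDyer.Theorems.ASideJunction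

namespace Summit.BirchSwinnertonDyer.BirchSwinnertonDyer.Theorems.KatoFiniteLevelCount

/-! ## §1 `#G[p^k]` is a power of `p` dividing `p^{v_p(#G_tors)}` -/

section PPart

/-- **`#G[p^k] ∣ p^{v_p(#G_tors)}`** for a finite abelian group `G`: every prime `q ∣ #G[p^k]` gives an element of order `q` killed by `p^k` (Cauchy), so
`q = p` and `#G[p^k]` is a power of `p`; it divides `#G_tors`, hence `p^{v_p(#G_tors)}`. [cite: SilvermanAEC2009, VII.3 and VIII.6 (the torsion subgroup)] -/
theorem natCard_torsionBy_pow_dvd_pow_padicValNat {G : Type*} [AddCommGroup G] [Finite G] (p : ℕ) [hp : Fact p.Prime] (k : ℕ) :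
    Nat.card ↥(G[((p ^ k : ℕ) : ℤ)]) ∣ p ^ padicValNat p (Nat.card (AddCommGroup.torsion G)) := by
  set H : AddSubgroup G := G[((p ^ k : ℕ) : ℤ)] with hH
  have hcard0 : Nat.card H ≠ 0 := Nat.card_pos.ne'
  -- every prime divisor of `#H` is `p`
  have hprime : ∀ {d : ℕ}, d.Prime → d ∣ Nat.card H → d = p := by
    intro d hd hdvd
    haveI : Fact d.Prime := ⟨hd⟩
    obtain ⟨x, hx⟩ := exists_prime_addOrderOf_dvd_card' (G := H) d hdvd
    have hpk : addOrderOf x ∣ p ^ k := by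
      apply addOrderOf_dvd_of_nsmul_eq_zero
      have h := AddSubgroup.torsionBy.nsmul (A := G) (n := p ^ k) x
      exact h
    rw [hx] at hpk
    exact (Nat.prime_dvd_prime_iff_eq hd hp.out).mp (hd.dvd_of_dvd_pow hpk)
  obtain ⟨m, hm⟩ : ∃ m : ℕ, Nat.card H = p ^ m := ⟨_, Nat.eq_prime_pow_of_unique_prime_dvd hcard0 hprime⟩
  -- `#H ∣ #G_tors`
  have hdvd : Nat.card H ∣ Nat.card (AddCommGroup.torsion G) :=
    AddSubgroup.card_dvd_of_le fun x hx => by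
      rw [AddCommGroup.mem_torsion, isOfFinAddOrder_iff_zsmul_eq_zero]
      exact ⟨((p ^ k : ℕ) : ℤ), Int.natCast_ne_zero.mpr (pow_ne_zero k hp.out.ne_zero),
        (Submodule.mem_torsionBy_iff (R := ℤ) _ x).mp hx⟩
  rw [hm] at hdvd ⊢
  exact pow_dvd_pow p ((padicValNat_dvd_iff_le Nat.card_pos.ne').mp hdvd)

end PPart

/-! ## §2 The count with the `p`-part of the torsion -/

section Count

variable (W : WeierstrassCurve ℚ) [W.IsElliptic] (p : ℕ) [Fact p.Prime] [ContinuousSMul ℤ_[p] (W.tateModule p)]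
  (𝓤inf 𝓢inf : SelmerStructure (primaryGaloisModule W p))

/-- **THE LEVEL-0 COUNT OF CRUX M, `p`-PART TORSION SLACK:
`p^{v_p(Tam W)} · #Ш(W)[p^∞] · [A : ℤ_p y₀] ≤ p^{v_p(c_p)} · #Sel_str^{ur}(W[p^∞]) · p^e · (p^{v_p #W(ℚ)_tors})²`** — hypotheses exactly as
`tamagawa_mul_sha_mul_index_le_of_zetaLineIndex` (part 53: `W(ℚ)`, `Ш[p^∞]` finite; `p` odd; `p^N A ⊆ ℤ_p y₀`; brick (b″) with exponent `e`; the named fact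
`poitouTate_selmerStructure_duality ℚ`).  [cite: Kato2004Asterisque, Prop. 14.16 and its proof (pp. 244–245), Lemma 14.18 (pp. 247–248)]
[cite: MilneADT2006, Ch. I, Thm. 4.10 (b)] -/
theorem tamagawa_mul_sha_mul_index_le_ppart_of_zetaLineIndex (hPT : poitouTate_selmerStructure_duality ℚ) (hodd : p ≠ 2) (T : Finset (HeightOneSpectrum (𝓞 ℚ)))
    (hpT : primePlace p ∈ T) (hT : ∀ v : HeightOneSpectrum (𝓞 ℚ), v ∉ T → W.HasGoodReductionAt v)
    [Finite W.toAffine.Point] [Finite (AddCommGroup.primaryComponent (↥W.sha) p)]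
    (hUp : 𝓤inf (Sum.inr (primePlace p)) = ⊤)
    (hUur : ∀ v : HeightOneSpectrum (𝓞 ℚ), v ≠ primePlace p →
      𝓤inf (Sum.inr v) = unramifiedSubgroup (GaloisRep.toLocal v (primaryGaloisModule W p)) 1)
    (hUinl : ∀ w : InfinitePlace ℚ, 𝓤inf (Sum.inl w) = ⊤)
    (hSp : 𝓢inf (Sum.inr (primePlace p)) = ⊥)
    (hSur : ∀ v : HeightOneSpectrum (𝓞 ℚ), v ≠ primePlace p →
      𝓢inf (Sum.inr v) = unramifiedSubgroup (GaloisRep.toLocal v (primaryGaloisModule W p)) 1)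
    (hSinl : ∀ w : InfinitePlace ℚ, 𝓢inf (Sum.inl w) = ⊤)
    (y₀ : H1 (tateRep W p) ⊤) (hy₀ : y₀ ∈ integralH1 (tateRep W p) p ⊤) (N : ℕ)
    (hN : ∀ a ∈ integralH1 (tateRep W p) p ⊤, ((p ^ N : ℕ) : ℤ) • a ∈ (ℤ_[p] ∙ y₀).toAddSubgroup) (e : ℕ)
    (hb : ∃ k₁ : ℕ, ∀ k : ℕ, k₁ ≤ k → ∀ j : ℕ,
      haveI := neZero_pow p j; haveI := neZero_pow p k
      haveI : Finite (geomTorsion W ((p ^ k : ℕ) : ℤ)) := finite_geomTorsion_pow W p k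
      ∀ (inv : LocalInvariants ℚ (p ^ j * p ^ k)), inv.SumLocalTermEqZero → inv.IsPerfect →
      ∀ (ε : geomTorsion W ((p ^ j * p ^ k : ℕ) : ℤ) → geomTorsion W ((p ^ j * p ^ k : ℕ) : ℤ) → AlgebraicClosure ℚ)
        (hμ : ∀ S T, ε S T ^ (p ^ j * p ^ k) = 1)
        (hadd₁ : ∀ S₁ S₂ T, ε (S₁ + S₂) T = ε S₁ T * ε S₂ T)
        (hadd₂ : ∀ S T₁ T₂, ε S (T₁ + T₂) = ε S T₁ * ε S T₂)
        (hgal : ∀ (σ : absoluteGaloisGroup ℚ) (S T : geomTorsion W ((p ^ j * p ^ k : ℕ) : ℤ)), σ • ε S T = ε (σ • S) (σ • T)),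
      p ^ k ∣ ((((ℤ_[p] ∙ y₀).toAddSubgroup.map
                  (((galoisCohomology.map (W.torsionInclusion (intPow_dvd_natCast_pow p k)) 1).comp
                      (ofTopSubgroup (W.torsionGaloisModule ((p : ℤ) ^ k)).toTopRep 1).hom.toLinearMap.toAddMonoidHom).comp
                    (reduceH1Pk W p k ⊤))).map
                  (galoisCohomology.map (DiscreteGaloisModule.pairingDualIntertwining
                    (ρ₁ := W.torsionGaloisModule ((p ^ k : ℕ) : ℤ)) (ρ₂ := W.torsionGaloisModule ((p ^ k : ℕ) : ℤ))
                    (B := descendHom W (p ^ j) (p ^ k) ε hμ hadd₁ hadd₂)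
                    (descendHom_smul W (p ^ j) (p ^ k) ε hμ hadd₁ hadd₂ hgal)) 1)).map
                (galoisCohomology.localization ((W.torsionGaloisModule ((p ^ k : ℕ) : ℤ)).tateDual (p ^ j * p ^ k))
                  (Sum.inr (primePlace p)) 1) ⊓
              annRight (localTatePairingZMod (W.torsionGaloisModule ((p ^ k : ℕ) : ℤ)) (p ^ j * p ^ k)
                (Sum.inr (primePlace p)) (inv (Sum.inr (primePlace p))))
                (W.kummerSelmerStructure ((p ^ k : ℕ) : ℤ) (Sum.inr (primePlace p)))).relIndex
              ((((ℤ_[p] ∙ y₀).toAddSubgroup.map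
                  (((galoisCohomology.map (W.torsionInclusion (intPow_dvd_natCast_pow p k)) 1).comp
                      (ofTopSubgroup (W.torsionGaloisModule ((p : ℤ) ^ k)).toTopRep 1).hom.toLinearMap.toAddMonoidHom).comp
                    (reduceH1Pk W p k ⊤))).map
                  (galoisCohomology.map (DiscreteGaloisModule.pairingDualIntertwining
                    (ρ₁ := W.torsionGaloisModule ((p ^ k : ℕ) : ℤ)) (ρ₂ := W.torsionGaloisModule ((p ^ k : ℕ) : ℤ))
                    (B := descendHom W (p ^ j) (p ^ k) ε hμ hadd₁ hadd₂)
                    (descendHom_smul W (p ^ j) (p ^ k) ε hμ hadd₁ hadd₂ hgal)) 1)).map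
                (galoisCohomology.localization ((W.torsionGaloisModule ((p ^ k : ℕ) : ℤ)).tateDual (p ^ j * p ^ k))
                  (Sum.inr (primePlace p)) 1)) * p ^ e) :
    p ^ padicValNat p W.tamagawaProduct * Nat.card (AddCommGroup.primaryComponent (↥W.sha) p) *
        (ℤ_[p] ∙ y₀).toAddSubgroup.relIndex (integralH1 (tateRep W p) p ⊤).toAddSubgroup ≤
      p ^ padicValNat p ((W.baseChange ((primePlace p).adicCompletion ℚ)).localTamagawaNumber
          ((primePlace p).adicCompletionIntegers ℚ)) * Nat.card 𝓢inf.selmerGroup * p ^ e * (p ^ padicValNat p W.torsionOrder) ^ 2 := by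
  have hp : p.Prime := Fact.out
  obtain ⟨k₁, hb⟩ := hb
  obtain ⟨j, s, k₀, hA⟩ :=
    exists_forall_aSide_le_classical_of_dvd W p 𝓤inf 𝓢inf hodd T hpT hT hUp hUur hUinl hSp hSur hSinl y₀ hy₀ N hN
  -- the level
  obtain ⟨k, hk₀, hk₁, hNe, hk1⟩ : ∃ k : ℕ, k₀ ≤ k ∧ k₁ ≤ k ∧ N + e ≤ k ∧ 1 ≤ k :=
    ⟨max (max k₀ k₁) (N + e) + 1, by omega, by omega, by omega, by omega⟩
  haveI := neZero_pow p j; haveI := neZero_pow p s; haveI := neZero_pow p k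
  haveI : Finite (geomTorsion W ((p ^ k : ℕ) : ℤ)) := finite_geomTorsion_pow W p k
  haveI : Finite (geomTorsion W ((p ^ s * p ^ k : ℕ) : ℤ)) :=
    W.finite_torsionPoints_holds (AlgebraicClosure ℚ) (Int.natCast_ne_zero.mpr (NeZero.ne (p ^ s * p ^ k)))
  have hpk2 : 2 ≤ p ^ k := le_trans hp.two_le (Nat.le_self_pow (by omega) p)
  -- the Poitou–Tate families and the Weil data at the two auxiliary levels
  obtain ⟨inv, hperf, hsum, -, -⟩ := hPT (p ^ j * p ^ k)
  obtain ⟨ε, hμ, hadd₁, hadd₂, -, -, hgal⟩ := (W.exists_weilPairing_holds (p ^ j * p ^ k))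
    (le_trans hpk2 (Nat.le_mul_of_pos_left _ (pow_pos hp.pos j))) (Nat.cast_ne_zero.mpr (NeZero.ne (p ^ j * p ^ k)))
  obtain ⟨inv', hperf', -, -, hcompl'⟩ := hPT (p ^ s * p ^ k)
  obtain ⟨e', hμ', hadd₁', hadd₂', halt', hnondeg', hgal'⟩ := (W.exists_weilPairing_holds (p ^ s * p ^ k))
    (le_trans hpk2 (Nat.le_mul_of_pos_left _ (pow_pos hp.pos s))) (Nat.cast_ne_zero.mpr (NeZero.ne (p ^ s * p ^ k)))
  -- brick (b″) at the level `k`: `p^k ∣ r·p^e`, hence `p^N ∣ r` and `p^k ≤ r·p^e`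
  have hbk := hb k hk₁ j inv hsum hperf ε hμ hadd₁ hadd₂ hgal
  have hdvd := pow_dvd_of_pow_dvd_mul_pow hp.pos hbk hNe
  haveI : Finite (galoisCohomology (((W.torsionGaloisModule ((p ^ k : ℕ) : ℤ)).tateDual (p ^ j * p ^ k)).toLocal
      (Sum.inr (primePlace p))) 1) := finite_galoisCohomology_one_tateDual_toLocal _ _ _
  have hrle := le_of_dvd_mul_of_ne_zero hbk (relIndex_ne_zero_of_finite _ _) (pow_ne_zero e hp.ne_zero)
  -- part 52
  have h := hA k hk₀ inv hsum hperf ε hμ hadd₁ hadd₂ hgal hdvd e' hμ' hadd₁' hadd₂' hgal' halt' hnondeg' inv' hperf' hcompl'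
  -- the torsion factor, `p`-part: `#W(ℚ)[p^k] · #W(ℚ)[p^N] ∣ (p^{v_p #W(ℚ)_tors})²`
  have htO : Nat.card (AddCommGroup.torsion W.toAffine.Point) = W.torsionOrder := by
    unfold WeierstrassCurve.torsionOrder; convert rfl
  have htors : Nat.card ↥(W.toAffine.Point[((p ^ k : ℕ) : ℤ)]) * Nat.card ↥(W.toAffine.Point[((p ^ N : ℕ) : ℤ)]) ≤
      (p ^ padicValNat p W.torsionOrder) ^ 2 := by
    rw [← htO, sq]
    exact Nat.le_of_dvd (Nat.mul_pos (pow_pos hp.pos _) (pow_pos hp.pos _))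
      (mul_dvd_mul (natCard_torsionBy_pow_dvd_pow_padicValNat p k) (natCard_torsionBy_pow_dvd_pow_padicValNat p N))
  exact count_arith h hrle htors (pow_pos hp.pos k)

end Count

end Summit.BirchSwinnertonDyer.BirchSwinnertonDyer.Theorems.KatoFiniteLevelCount

end
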